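import Summits.QuantumFields.YangMills.Theorems.FlatTubeReductionDecimationSlices
import HarnessLib

/-!
# Route `FlatTubeReduction`, crux `PinnedUnitStepEx` (stmt-QuantumFields-27561), stub `stub_smearVarPosGS1` — D4b: contractible slices of a fine support

Seat ym-line-fcl-p3 g9 (2026-08-28).  Blueprint file D4 (second part) = memo §P4 (C1) at one doubled slab: for a coarse link set `R ⊆ Edge 3 L'`, a
decoder `v ∈ (ℤ/(L'+1))³` and a direction `j`,
* `isContr_fineSupp_deleted` — the DELETED fine slice `x_j = 1 − v_j` of `fineSupp (L'+1) v R` is always contractible;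
* `isContr_fineSupp_iff` — the fine slice `x_j = ι a − v_j` is contractible iff the coarse slice `x_j = a` of `R` is.
(`ι = thinCoord (L'+1) L'`; every fine slice is of one of these two kinds, `exists_thinCoord_eq`.)  So the contractible fine slices are the images
of the contractible coarse slices plus the deleted one, in every direction — the run structure of the fine support is that of `R` with one slice
inserted right after coarse slice `0`.  R2b1 RECORD rung; no summit/crux/stub here.
-/

set_option autoImplicit false

namespace Summit.QuantumFields.YangMills.Theorems.FlatTubeReduction.Decimation

open Finset Function
open Literature.MathematicalPhysics.QuantumFieldTheory (Site Edge)
open Summit.QuantumFields.YangMills.Theorems.FemtoCutoffLadder.Thinning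

variable {L' : ℕ} [NeZero L']

/-- A fine site none of whose coordinates is deleted is the image of a coarse site. [folklore] -/
theorem exists_thinSite_sub_eq {v y : Site 3 (L' + 1)} (h : ∀ k, y k + v k ≠ 1) :
    ∃ x' : Site 3 L', thinSite (L' + 1) x' - v = y := by
  choose a ha using fun k => exists_thinCoord_eq (L' := L') (h k)
  refine ⟨fun k => a k, funext fun k => ?_⟩
  simp only [Pi.sub_apply, thinSite, ha k, add_sub_cancel_right]

/-- A fine site on the deleted `j`-slice, with no other coordinate deleted, is the middle site of a doubled `j`-path. [folklore] -/
theorem exists_thinSite_mid_eq {v y : Site 3 (L' + 1)} {j : Fin 3} (hj : y j = 1 - v j) (h : ∀ k, k ≠ j → y k + v k ≠ 1) :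
    ∃ x' : Site 3 L', x' j = 0 ∧ thinSite (L' + 1) x' + Pi.single j 1 - v = y := by
  classical
  have hex : ∀ k, ∃ a : ZMod L', k ≠ j → thinCoord (L' + 1) L' a = y k + v k := by
    intro k
    by_cases hk : k = j
    · exact ⟨0, fun h' => absurd hk h'⟩
    · obtain ⟨a, ha⟩ := exists_thinCoord_eq (L' := L') (h k hk)
      exact ⟨a, fun _ => ha⟩
  choose a ha using hex
  refine ⟨fun k => if k = j then 0 else a k, by simp, funext fun k => ?_⟩
  simp only [Pi.sub_apply, Pi.add_apply, thinSite, Pi.single_apply]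
  by_cases hk : k = j
  · subst hk
    simp only [if_true, (thinCoord_eq_zero_iff (Nat.le_succ L') 0).2 rfl, zero_add, hj]
  · simp only [if_neg hk, add_zero, ha k hk, add_sub_cancel_right]

/-- ★ **The deleted slice is contractible**: the fine slice `x_j = 1 − v_j` of `fineSupp (L'+1) v R` carries no transverse link, and its incoming
and outgoing `j`-links are the two halves of the same doubled paths. [folklore] -/
theorem isContr_fineSupp_deleted (v : Site 3 (L' + 1)) (R : Finset (Edge 3 L')) (j : Fin 3) :
    IsContr j (1 - v j) (fineSupp (L' + 1) v R) := by
  refine ⟨fun e he hej => ?_, fun y hy => ?_⟩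
  · by_contra hne
    exact apply_ne_deleted_of_mem_fineSupp (y := e.1) (i := e.2) he (Ne.symm hne) hej
  · by_cases hdel : ∃ k, k ≠ j ∧ y k + v k = 1
    · obtain ⟨k, hkj, hk⟩ := hdel
      have hyk : y k = 1 - v k := by rw [← hk, add_sub_cancel_right]
      have h1 : (y, j) ∉ fineSupp (L' + 1) v R := fun h => apply_ne_deleted_of_mem_fineSupp h hkj hyk
      have h2 : (y - Pi.single j 1, j) ∉ fineSupp (L' + 1) v R := fun h =>
        apply_ne_deleted_of_mem_fineSupp h hkj (by simp [Pi.sub_apply, hkj, hyk])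
      exact ⟨fun h => absurd h h2, fun h => absurd h h1⟩
    · push Not at hdel
      obtain ⟨x', hx0, hx⟩ := exists_thinSite_mid_eq hy hdel
      rw [← hx, add_sub_right_comm, add_sub_cancel_right, ← add_sub_right_comm, mid_mem_fineSupp_iff v R hx0, out_mem_fineSupp_iff]

/-- ★★ **Contractible fine slices are the images of contractible coarse slices**: for every coarse coordinate `a`, the fine slice
`x_j = ι a − v_j` of `fineSupp (L'+1) v R` is contractible iff the coarse slice `x_j = a` of `R` is. [folklore] -/
theorem isContr_fineSupp_iff (v : Site 3 (L' + 1)) (R : Finset (Edge 3 L')) (j : Fin 3) (a : ZMod L') :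
    IsContr j (thinCoord (L' + 1) L' a - v j) (fineSupp (L' + 1) v R) ↔ IsContr j a R := by
  have hinj := thinCoord_injective (L := L' + 1) (L' := L') (Nat.le_succ L')
  constructor
  · rintro ⟨hi, hii⟩
    refine ⟨fun e' he' hej => ?_, fun x' hx' => ?_⟩
    · -- a transverse coarse link in slice `a` has its first path link in the fine slice
      by_contra hne
      have hout := (out_mem_fineSupp_iff v R e'.1 e'.2).2 he'
      have := hi _ hout (by simp only [Pi.sub_apply, thinSite, hej])
      exact hne this
    · have hy : (thinSite (L' + 1) x' - v) j = thinCoord (L' + 1) L' a - v j := by simp only [Pi.sub_apply, thinSite, hx']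
      have := hii _ hy
      rwa [in_mem_fineSupp_iff, out_mem_fineSupp_iff] at this
  · rintro ⟨hi, hii⟩
    refine ⟨fun e he hej => ?_, fun y hy => ?_⟩
    · by_contra hne
      obtain ⟨x', hR, hyj⟩ := exists_coarse_of_mem_fineSupp_transverse (y := e.1) (i := e.2) he (Ne.symm hne)
      rw [hej] at hyj
      have hxa : x' j = a := (hinj (sub_left_injective hyj)).symm
      exact hne (hi _ hR hxa)
    · by_cases hdel : ∃ k, y k + v k = 1
      · obtain ⟨k, hk⟩ := hdel
        have hkj : k ≠ j := by
          rintro rfl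
          rw [hy, sub_add_cancel] at hk
          exact thinCoord_ne_one a hk
        have hyk : y k = 1 - v k := by rw [← hk, add_sub_cancel_right]
        have h1 : (y, j) ∉ fineSupp (L' + 1) v R := fun h => apply_ne_deleted_of_mem_fineSupp h hkj hyk
        have h2 : (y - Pi.single j 1, j) ∉ fineSupp (L' + 1) v R := fun h =>
          apply_ne_deleted_of_mem_fineSupp h hkj (by simp [Pi.sub_apply, hkj, hyk])
        exact ⟨fun h => absurd h h2, fun h => absurd h h1⟩
      · push Not at hdel
        obtain ⟨x', hx⟩ := exists_thinSite_sub_eq hdel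
        have hxa : x' j = a := by
          have := congrFun hx j
          simp only [Pi.sub_apply, thinSite, hy] at this
          exact hinj (sub_left_injective this)
        rw [← hx, in_mem_fineSupp_iff, out_mem_fineSupp_iff]
        exact hii x' hxa

end Summit.QuantumFields.YangMills.Theorems.FlatTubeReduction.Decimation
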